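import Summits.Ventures.AbcSig.Rows.Bridge
import Summits.Ventures.AbcSig.Rows.C2aL29A6eq
import Summits.Ventures.AbcSig.Rows.C2aL29A6eqAB

/-!
# Venture AbcSig — CELL `C2aL29A6eq`: the census statement `Rows.C2aCellRed 29 (fun a => a = 6) ∅` from the two row theorems

HONEST FRAMING. COMPUTATION cell `pub-abcsig`; CONDITIONAL theorem; no claim on ABC or any summit. Hypotheses exactly as
in `Rows/C2aL29A6eq.lean` and `Rows/C2aL29A6eqAB.lean`: `BS04Package` (CITED), `DataComplete …` (COMPUTED level files), and the
rows' per-orbit exclusions for BOTH family predicates (`famB`, `famAB`) as universally quantified hypotheses (CITED: the census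
row's certificates). Conclusion = p1's census predicate (`Rows/Statements.lean`), all four coprime coefficient
distributions `A·B = 2^a·29^m`, reduced exponents `a < n`, `m < n` (RULING H1). GENERATED by p-lean g2 gen/make_rows.py
(after plean/make_cell_bridges.py).
-/

namespace Summit.Ventures.AbcSig

/-- Cell `C2aL29A6eq`: `Rows.C2aCellRed 29 (fun a => a = 6) ∅` under the rows' hypotheses. -/
theorem cell_C2aL29A6eq (M : NewformModel) (hP : M.BS04Package)
    (hD29 : M.DataComplete 29 level29Orbits)
    (hD58 : M.DataComplete 58 level58Orbits) :
    Rows.C2aCellRed 29 (fun a => a = 6) ∅ :=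
  C2aCellRed_of_rows 29 (by norm_num) (by norm_num) _ _
    (fun n hn h11 hnℓ _ a m (ha : a = 6) han hm hmn x y z h1 h2 => by
      subst ha
      exact
 row_C2aL29A6eq M hP hD29 hD58 n hn h11 hnℓ m hm hmn x y z h1 h2)
    (fun n hn h11 hnℓ _ a m (ha : a = 6) han hm hmn x y z h1 h2 => by
      subst ha
      exact
 row_C2aL29A6eqAB M hP hD29 hD58 n hn h11 hnℓ m hm hmn x y z h1 h2)

end Summit.Ventures.AbcSig
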